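import Literature.AnabelianGeometry.EtaleTheta.SettingModelKrullTheta
import Literature.AnabelianGeometry.EtaleTheta.SettingModelKrullGroupLevel
import Literature.AnabelianGeometry.EtaleTheta.SettingModel2CommutatorCusp
import Literature.AnabelianGeometry.EtaleTheta.SettingBridge
import HarnessLib

/-!
# The UNTWISTED KRULL model of the [EtTh] §1 root, file K3b: the COMMUTATOR-AXIS cusp `D_x = c^Ẑ ⋊ G_{ℚ_p}`, the
# cusped records `curveκ′` / `ThetaSetting.modelκ′`, their once-punctured parameters (NO binder), and the
# commutator-axis clause `toHat(I_x) = ⟨[a,b]⟩⁻` with a COMPACT decomposition group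

Mochizuki, *The étale theta function …*, Publ. RIMS **45** (2009) [EtTh], §1 p. 13 («any decomposition group of a
cusp»), §2 p. 35 («the inertia group `I_x ⊆ D_x` isomorphically onto `Δ̄_Θ`»); [SemiAnbd] §6 p. 71 («`I_x ≅ Ẑ(1)`»)
[cite: MochizukiEtTh2009, §1 p.13]. Cell abc-iut, layer L2, seat abc-iut-L2-t10 (gen 5), row «coverDataAx FULLY
INSTANTIATED», file K3b over K2/K3a and abc-iut-w5-d165's commutator axis (`SettingModel2CommutatorCusp`: `cAxisGfp
= c^Ẑ ⊆ Γ`, `cAxis_eq_closure_zpowers`, `cAxisGfpEquiv`, consumed BY NAME). Because the Galois action on `Γ` is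
TRIVIAL in the Krull model, the commutator axis IS Galois-stable, so:

* `cuspDecompκ p := {g | g.left ∈ c^Ẑ} = c^Ẑ ⋊ G_{ℚ_p} ≤ Π^tp_X` — closed, onto `G_{ℚ_p}`, inertia `≃ₜ* Ẑ`, COMPACT
  (`isCompact_cuspDecompκ`: `c^Ẑ × G_{ℚ_p}` under the homeomorphism `Π^tp_X ≃ₜ Γ × G_{ℚ_p}`);
* **`curveκ′ p`**, **`ThetaSetting.modelκ′ p`** (the K2 record over the cusped carrier; re-keyed `Normal` instances);
  `modelκ'_isEtThOrigin`, (P1) `ker_augHat_modelκ'`, (P2) `exists_isCusp_modelκ'`, (P3) `decomp_modelκ'_le_ker_toZ`,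
  (P4) `map_aug_decomp_modelκ'`, and **`nonempty_oncePuncturedData_modelκ'`** — `OncePuncturedData` with NO binder
  (group-level datum from K3a);
* **`map_toHat_inertia_modelκ'`**: `toHat(I_x) = ⟨⁅a,b⁆⟩⁻` for `a = inl(η a)`, `b = inl(η b)` — the commutator-axis
  clause ON THE NOSE — and `closure_pair_inl_eta_eq_top` (that pair topologically generates `Δ̂_X`).

SEMI-SYNTHETIC (consistency evidence only). Class (b): `cuspDecompκ`, `inertiaEquivκ`, the two records; no `Prop`
fact; nothing of [EtTh]/[SemiAnbd] asserted; no side taken on [IUTchIII] Cor. 3.12; typed ≠ proved.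
-/

noncomputable section

namespace Literature.AnabelianGeometry.EtaleTheta.SettingModel

open Literature.AnabelianGeometry.SemiGraphs _root_.Topology _root_.Function
open scoped commutatorElement

variable (p : ℕ) [Fact p.Prime]

/-! ## §1. The commutator-axis cusp datum on `Π^tp_X = Γ ⋊_{θ∘1} G_{ℚ_p}` -/

/-- **`D_x := c^Ẑ ⋊ G_{ℚ_p} = {g | g.left ∈ c^Ẑ}`** — a subgroup because the action is trivial.
[cite: MochizukiEtTh2009, §1 p.13] -/
def cuspDecompκ : Subgroup (PiTpκ p) where
  carrier := {g | g.left ∈ cAxisGfp}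
  one_mem' := by
    change (1 : PiTpκ p).left ∈ cAxisGfp
    rw [SemidirectProduct.one_left]; exact Subgroup.one_mem _
  mul_mem' {a b} ha hb := by
    change (a * b).left ∈ cAxisGfp
    rw [SemidirectProduct.mul_left, actκ_apply_eq]
    exact Subgroup.mul_mem _ ha hb
  inv_mem' {a} ha := by
    change a⁻¹.left ∈ cAxisGfp
    rw [SemidirectProduct.inv_left, actκ_apply_eq]
    exact Subgroup.inv_mem _ ha

/-- [cite: MochizukiEtTh2009, §1 p.13] -/
theorem mem_cuspDecompκ_iff (g : PiTpκ p) : g ∈ cuspDecompκ p ↔ g.left ∈ cAxisGfp := Iff.rfl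

/-- `D_x` is closed. [cite: MochizukiSemiAnbd2006, §6 p.71] -/
theorem isClosed_cuspDecompκ : IsClosed (cuspDecompκ p : Set (PiTpκ p)) :=
  isClosed_cAxisGfp.preimage (Semidirect.continuous_left (isInducing_leftRightκ p))

/-- `D_x` is COMPACT (`c^Ẑ × G_{ℚ_p}` under `Π^tp_X ≃ₜ Γ × G_{ℚ_p}`). [cite: MochizukiSemiAnbd2006, §6 p.71] -/
theorem isCompact_cuspDecompκ : IsCompact (cuspDecompκ p : Set (PiTpκ p)) := by
  haveI := compactSpace_GQp p
  have hset : (cuspDecompκ p : Set (PiTpκ p)) =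
      (Semidirect.homeomorphProd (isInducing_leftRightκ p)) ⁻¹' ((cAxisGfp : Set Gfp) ×ˢ (Set.univ : Set (GQp p))) := by
    ext g
    rw [SetLike.mem_coe, mem_cuspDecompκ_iff, Set.mem_preimage, Set.mem_prod]
    exact ⟨fun h => ⟨h, Set.mem_univ _⟩, fun h => h.1⟩
  have hc : IsCompact (cAxisGfp : Set Gfp) := by
    have h : (cAxisGfp : Set Gfp) = Set.range cPowGfp := by rw [cAxisGfp, MonoidHom.coe_range]; rfl
    rw [h]; exact isCompact_range cPowGfp.continuous
  rw [hset]
  exact (Semidirect.homeomorphProd (isInducing_leftRightκ p)).isCompact_preimage.mpr (hc.prod isCompact_univ)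

/-- `aug(D_x) = G_{ℚ_p}`. [cite: MochizukiEtTh2009, §1 p.13] -/
theorem augκ_image_cuspDecompκ : (augκ p) '' (cuspDecompκ p : Set (PiTpκ p)) = Set.univ :=
  Set.eq_univ_of_forall fun σ => ⟨SemidirectProduct.inr σ,
    by rw [SetLike.mem_coe, mem_cuspDecompκ_iff, SemidirectProduct.left_inr]; exact Subgroup.one_mem _, rfl⟩

/-- As subgroups: `aug(D_x) = ⊤`. [cite: MochizukiEtTh2009, §1 p.13] -/
theorem map_augκ_cuspDecompκ : (cuspDecompκ p).map (augκ p).toMonoidHom = ⊤ := by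
  apply SetLike.coe_injective
  rw [Subgroup.coe_map, Subgroup.coe_top]
  exact augκ_image_cuspDecompκ p

/-- The inertia `I_x = D_x ∩ Ker(aug) = inl(c^Ẑ)`. [cite: MochizukiSemiAnbd2006, §6 p.71] -/
theorem cuspDecompκ_inf_ker :
    cuspDecompκ p ⊓ (augκ p).toMonoidHom.ker = cAxisGfp.map (SemidirectProduct.inl : Gfp →* PiTpκ p) := by
  ext g
  rw [Subgroup.mem_inf, mem_cuspDecompκ_iff, MonoidHom.mem_ker]
  constructor
  · rintro ⟨hl, hr⟩
    refine ⟨g.left, hl, ?_⟩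
    change (augκ p) g = 1 at hr
    rw [augκ_apply] at hr
    exact SemidirectProduct.ext (SemidirectProduct.left_inl _) (by rw [SemidirectProduct.right_inl]; exact hr.symm)
  · rintro ⟨q, hq, rfl⟩
    exact ⟨by rwa [SemidirectProduct.left_inl], by change (augκ p) _ = 1; rw [augκ_apply, SemidirectProduct.right_inl]⟩

/-- `I_x = {g | g.left ∈ c^Ẑ, g.right = 1} ≃ₜ* c^Ẑ ⊆ Γ` (first projection). [cite: MochizukiSemiAnbd2006, §6 p.71] -/
def inertiaSubgroupEquivκ : ↥(cuspDecompκ p ⊓ (augκ p).toMonoidHom.ker) ≃ₜ* cAxisGfp where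
  toFun g := ⟨g.1.left, g.2.1⟩
  invFun q := ⟨SemidirectProduct.inl q.1,
    ⟨show (SemidirectProduct.inl q.1 : PiTpκ p).left ∈ cAxisGfp from q.2, (MonoidHom.mem_ker).mpr rfl⟩⟩
  left_inv g := by
    apply Subtype.ext
    change SemidirectProduct.inl g.1.left = g.1
    have hr : g.1.right = 1 := by
      have h : (augκ p) g.1 = 1 := (MonoidHom.mem_ker).mp g.2.2
      rwa [augκ_apply] at h
    exact SemidirectProduct.ext (SemidirectProduct.left_inl _) (by rw [SemidirectProduct.right_inl]; exact hr.symm)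
  right_inv q := Subtype.ext rfl
  map_mul' g h := Subtype.ext (by
    change (g.1 * h.1).left = g.1.left * h.1.left
    rw [SemidirectProduct.mul_left, actκ_apply_eq])
  continuous_toFun := ((Semidirect.continuous_left (isInducing_leftRightκ p)).comp continuous_subtype_val).subtype_mk _
  continuous_invFun := ((continuous_inlκ p).comp continuous_subtype_val).subtype_mk _

/-- **`I_x ≃ₜ* Ẑ`** («`I_x ≅ Ẑ(1)`»). [cite: MochizukiSemiAnbd2006, §6 p.71] -/
def inertiaEquivκ : ↥(cuspDecompκ p ⊓ (augκ p).toMonoidHom.ker) ≃ₜ* ZHat :=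
  (inertiaSubgroupEquivκ p).trans cAxisGfpEquiv

/-! ## §2. The cusped records `curveκ′`, `modelκ′` -/

/-- **The cusped Krull curve**: `curveκ` with `Pt := Unit`, the point a cusp, `D_x := c^Ẑ ⋊ G_{ℚ_p}`.
[cite: MochizukiEtTh2009, §1 p.13] -/
abbrev curveκ' : TemperedCurve p where
  K := (curveκ p).K
  finiteDimensional_K := (curveκ p).finiteDimensional_K
  PiTemp := PiTpκ p
  aug := augκ p
  range_aug := (curveκ p).range_aug
  PiHat := PiHtκ p
  toHat := toHatκ p
  isProfiniteCompletion_toHat := isProfiniteCompletion_toHatκ p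
  toHat_injective := toHatκ_injective p
  augHat := augHatκ p
  augHat_comp := (curveκ p).augHat_comp
  Pt := Unit
  IsCusp _ := True
  decomp _ := cuspDecompκ p
  isClosed_decomp _ := isClosed_cuspDecompκ p
  isOpen_aug_decomp _ := by rw [augκ_image_cuspDecompκ]; exact isOpen_univ
  inertia_eq_bot _ h := (h trivial).elim
  inertia_equiv_zHat _ _ := ⟨inertiaEquivκ p⟩

/-- [cite: MochizukiEtTh2009, §1 p.12] -/
theorem curveκ'_deltaTemp : (curveκ' p).DeltaTemp = (curveκ p).DeltaTemp := rfl
/-- [cite: MochizukiEtTh2009, §1 p.12] -/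
theorem curveκ'_deltaHat : (curveκ' p).DeltaHat = (curveκ p).DeltaHat := rfl

/-- Re-keyed `Normal` instance at `curveκ′`. [cite: MochizukiEtTh2009, §1 p.12] -/
instance thetaKerκ'_normal : (CurveTheta.thetaKer (curveκ' p)).Normal := CurveTheta.thetaKer_normal _
/-- Re-keyed `Normal` instance at `curveκ′`. [cite: MochizukiEtTh2009, §1 p.12] -/
instance ellKerκ'_normal : (CurveTheta.ellKer (curveκ' p)).Normal := CurveTheta.ellKer_normal _

/-- `thetaKer ⊓ YNκ ≤ ZNκ` read at `curveκ′` (same groups as `curveκ`). [cite: MochizukiEtTh2009, §1 p.14] -/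
theorem thetaKer_inf_YNκ_le_ZNκ' (N : ℕ+) : CurveTheta.thetaKer (curveκ' p) ⊓ YNκ p N ≤ ZNκ p N :=
  thetaKer_inf_YNκ_le_ZNκ p N

/-- **The cusped Krull record `modelκ′`** — K2's `modelκ` verbatim over `curveκ′`. [cite: MochizukiEtTh2009, §1 p.11] -/
abbrev _root_.Literature.AnabelianGeometry.EtaleTheta.ThetaSetting.modelκ' : ThetaSetting p where
  toTemperedCurve := curveκ' p
  qX := qModel p
  qX_mem := qModel_mem_botχ p
  norm_qX_lt_one := (ThetaSetting.model p).norm_qX_lt_one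
  qX_ne_zero := qModel_ne_zeroχ p
  sqrtqX := ((p : ℕ) : PadicAlgCl p)
  sqrtqX_sq := rfl
  toZ := (krullTwistData p).toZ
  toZ_surjective := (krullTwistData p).toZ_surjective
  isOpen_ker_toZ := (krullTwistData p).isOpen_ker_toZ (continuous_leftRightκ p)
  toZ_delta_surjective := (krullTwistData p).toZ_restrict_surjective
  GtpTheta := CurveTheta.GTheta (curveκ' p)
  toTheta := CurveTheta.toTheta (curveκ' p)
  continuous_toTheta := CurveTheta.continuous_toTheta (curveκ' p)
  toTheta_surjective := CurveTheta.toTheta_surjective (curveκ' p)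
  ker_toTheta := CurveTheta.ker_toTheta (curveκ' p)
  GtpEll := CurveTheta.GEll (curveκ' p)
  thetaToEll := CurveTheta.thetaToEll (curveκ' p)
  continuous_thetaToEll := CurveTheta.continuous_thetaToEll (curveκ' p)
  thetaToEll_surjective := CurveTheta.thetaToEll_surjective (curveκ' p)
  ker_toEll := CurveTheta.ker_toEll (curveκ' p)
  ker_thetaToEll_comm := CurveTheta.ker_thetaToEll_comm (curveκ' p)
  ker_thetaToEll_central := CurveTheta.ker_thetaToEll_central (curveκ' p)
  GtpYN := YNκ p
  GtpYN_one := YNκ_one p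
  GtpYN_le := YNκ_le p
  map_aug_GtpYN N := map_rightHom_YNκ p N
  GtpYN_normal := YNκ_normal p
  isOpen_GtpYN N := isOpen_YNκ p (continuous_leftRightκ p) N (isOpen_fixingSubgroup_fieldKN ⊥ (qModel p) N)
  GtpYN_anti M N h := YNκ_anti p h
  relIndex_deltaYN N := relIndex_YNκ p N
  GtpZN := ZNκ p
  GtpZN_le := ZNκ_le_YNκ p
  map_aug_GtpZN N := map_rightHom_ZNκ p N
  GtpZN_normal := ZNκ_normal p
  isOpen_GtpZN N := isOpen_ZNκ p (continuous_leftRightκ p) N (isOpen_fixingSubgroup_fieldJN ⊥ (qModel p) N)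
  GtpZN_anti M N h := ZNκ_anti p h
  relIndex_deltaZN N := relIndex_ZNκ p N
  ker_toTheta_le_GtpZN N := by
    rw [CurveTheta.ker_toTheta]
    exact thetaKer_inf_YNκ_le_ZNκ' p N

/-- **`modelκ′` satisfies the guard `IsEtThOrigin`.** [cite: MochizukiEtTh2009, §1 p.12] -/
theorem _root_.Literature.AnabelianGeometry.EtaleTheta.ThetaSetting.modelκ'_isEtThOrigin :
    (ThetaSetting.modelκ' p).IsEtThOrigin :=
  ThetaSetting.IsEtThOrigin.of_free (isFreeProfiniteOnTwo_deltaHatκ p)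

/-- `toZ = pr₂ ∘ left`. [cite: MochizukiEtTh2009, §1 p.12] -/
theorem toZ_modelκ'_apply (g : PiTpκ p) : (ThetaSetting.modelκ' p).toZ g = gfpSnd g.left := rfl

/-- **(P3)** decomposition groups of cusps lie in `Π^tp_Y` (the `c`-axis has `a`-degree `0`). [cite: MochizukiEtTh2009, §1 p.13] -/
theorem decomp_modelκ'_le_ker_toZ (x : (ThetaSetting.modelκ' p).Pt) :
    (ThetaSetting.modelκ' p).decomp x ≤ (ThetaSetting.modelκ' p).toZ.ker := fun g hg => by
  rw [MonoidHom.mem_ker, toZ_modelκ'_apply]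
  exact cAxisGfp_le_ker_gfpSnd ((mem_cuspDecompκ_iff p g).mp hg)

/-- **(P4)** `D_x ↠ G_K`. [cite: MochizukiEtTh2009, §1 p.13] -/
theorem map_aug_decomp_modelκ' (x : (ThetaSetting.modelκ' p).Pt) :
    ((ThetaSetting.modelκ' p).decomp x).map (ThetaSetting.modelκ' p).aug.toMonoidHom = (ThetaSetting.modelκ' p).GK := by
  change (cuspDecompκ p).map (augκ p).toMonoidHom = (⊥ : IntermediateField ℚ_[p] _).fixingSubgroup
  rw [map_augκ_cuspDecompκ, IntermediateField.fixingSubgroup_bot]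

/-- **(P2)** there is a cusp. [cite: MochizukiEtTh2009, §1 p.12] -/
theorem exists_isCusp_modelκ' : ∃ x : (ThetaSetting.modelκ' p).Pt, (ThetaSetting.modelκ' p).IsCusp x := ⟨(), trivial⟩

/-- **(P1)** `Ker(Π_X → G_{ℚ_p}) = Δ̂_X` (Krull factor). [cite: MochizukiEtTh2009, §1 p.12] -/
theorem ker_augHat_modelκ' : (ThetaSetting.modelκ' p).augHat.toMonoidHom.ker = (ThetaSetting.modelκ' p).DeltaHat := by
  change (augHatκ p).toMonoidHom.ker = (curveκ p).DeltaHat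
  rw [deltaHatκ_eq]
  rfl

/-- The group-level datum at the CUSPED carrier `curveκ′` (same `Π^tp`, `aug` as `curveκ`: K3a's theorems transfer
field by field). [cite: MochizukiSemiAnbd2006, Ex 3.10 p.43] -/
theorem nonempty_groupLevelData_curveκ' : Nonempty (TemperedCurve.GroupLevelData (curveκ' p)) := by
  have hker : ((curveκ' p).augK (curveκ' p).galoisIdentification).toMonoidHom.ker = (curveκ' p).DeltaTemp :=
    (curveκ' p).ker_augK _
  exact ⟨{ galEquiv := (curveκ' p).galoisIdentification
           isTempered := isTempered_piTemp_curveκ p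
           isTempered_ker := by rw [hker, curveκ'_deltaTemp]; exact isTempered_deltaTemp_curveκ p
           isSlimGroup := isSlimGroup_PiTpκ p
           isSlimGroup_ker := by rw [hker, curveκ'_deltaTemp]; exact isSlimGroup_deltaTempκ p
           secondCountableTopology := secondCountableTopology_PiTpκ p }⟩

/-- **The once-punctured parameters of `modelκ′` are inhabited with NO binder.** [cite: MochizukiEtTh2009, §1 p.13] -/
theorem nonempty_oncePuncturedData_modelκ' : Nonempty (ThetaSetting.modelκ' p).OncePuncturedData :=
  ⟨{ toGroupLevelData := (nonempty_groupLevelData_curveκ' p).some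
     ker_augHat := ker_augHat_modelκ' p
     exists_cusp := exists_isCusp_modelκ' p
     decomp_le_ker_toZ := fun x _ => decomp_modelκ'_le_ker_toZ p x
     map_aug_decomp := fun x _ => map_aug_decomp_modelκ' p x
     origin := ThetaSetting.modelκ'_isEtThOrigin p }⟩

/-! ## §3. The commutator-axis clause `toHat(I_x) = ⟨[a,b]⟩⁻` -/

/-- `I_x = inl(c^Ẑ)` at `modelκ′`. [cite: MochizukiSemiAnbd2006, §6 p.71] -/
theorem inertia_modelκ'_eq (x : (ThetaSetting.modelκ' p).Pt) :
    (ThetaSetting.modelκ' p).inertia x = cAxisGfp.map (SemidirectProduct.inl : Gfp →* PiTpκ p) :=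
  cuspDecompκ_inf_ker p

/-- `inl : F̂₂ → Π_X` is a closed embedding (continuous injective, compact source, Hausdorff target).
[cite: MochizukiEtTh2009, §1 p.12] -/
theorem isClosedEmbedding_inlHatκ : IsClosedEmbedding (SemidirectProduct.inl : F₂hatT → PiHtκ p) :=
  (Semidirect.continuous_inl (isInducing_leftRightHatκ p)).isClosedEmbedding SemidirectProduct.inl_injective

/-- **`toHat(I_x) = ⟨⁅a,b⁆⟩⁻`** for `a = inl(η a)`, `b = inl(η b)` ∈ `Π_X`: the commutator-axis clause ON THE NOSE
(`toHat ∘ inl = inl ∘ pr₁`, `pr₁(c^Ẑ) = c^Ẑ ⊆ F̂₂ = ⟨η[a,b]⟩⁻` by abc-iut-w5-d165, `inl` a closed embedding).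
[cite: MochizukiEtTh2009, Def 2.1 p.35] -/
theorem map_toHat_inertia_modelκ' (x : (ThetaSetting.modelκ' p).Pt) :
    ((ThetaSetting.modelκ' p).inertia x).map (ThetaSetting.modelκ' p).toHat.toMonoidHom =
      (Subgroup.zpowers ⁅(SemidirectProduct.inl (eta (FreeGroup.of 0)) : PiHtκ p),
        SemidirectProduct.inl (eta (FreeGroup.of 1))⁆).topologicalClosure := by
  rw [inertia_modelκ'_eq, Subgroup.map_map]
  have hcomp : ((ThetaSetting.modelκ' p).toHat.toMonoidHom.comp (SemidirectProduct.inl : Gfp →* PiTpκ p)) =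
      (SemidirectProduct.inl : F₂hatT →* PiHtκ p).comp gfpFst.toMonoidHom := by
    refine MonoidHom.ext fun γ => ?_
    change toHatκ p (SemidirectProduct.inl γ) = SemidirectProduct.inl (gfpFst γ)
    exact SemidirectProduct.ext rfl rfl
  rw [hcomp, ← Subgroup.map_map, map_gfpFst_cAxisGfp, cAxis_eq_closure_zpowers]
  have hcl := ClassTwoBar.map_topologicalClosure_of_isClosedEmbedding
    (⟨(SemidirectProduct.inl : F₂hatT →* PiHtκ p), Semidirect.continuous_inl (isInducing_leftRightHatκ p)⟩ :
      F₂hatT →ₜ* PiHtκ p) (isClosedEmbedding_inlHatκ p) (Subgroup.zpowers (eta cElt))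
  change ((Subgroup.zpowers (eta cElt)).topologicalClosure).map (SemidirectProduct.inl : F₂hatT →* PiHtκ p) = _
  rw [show ((Subgroup.zpowers (eta cElt)).topologicalClosure).map (SemidirectProduct.inl : F₂hatT →* PiHtκ p) =
      ((Subgroup.zpowers (eta cElt)).map (SemidirectProduct.inl : F₂hatT →* PiHtκ p)).topologicalClosure from hcl,
    MonoidHom.map_zpowers, map_commutatorElement, map_commutatorElement]

/-- The pair `a = inl(η a)`, `b = inl(η b)` TOPOLOGICALLY GENERATES `Δ̂_X = inl(F̂₂)` (density of `η(F₂) = ⟨a,b⟩` in `F̂₂`,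
`inl : F̂₂ ≃ₜ* Δ̂_X`). [cite: MochizukiEtTh2009, §1 p.12] -/
theorem closure_pair_inl_eta_eq_top :
    (Subgroup.closure ({⟨SemidirectProduct.inl (eta (FreeGroup.of 0)), inl_mem_deltaHatκ p _⟩,
        ⟨SemidirectProduct.inl (eta (FreeGroup.of 1)), inl_mem_deltaHatκ p _⟩} :
        Set (ThetaSetting.modelκ' p).DeltaHat)).topologicalClosure = ⊤ := by
  -- transport along `deltaHatκEquiv : F̂₂ ≃ₜ* Δ̂_X`
  let e : F₂hatT ≃ₜ* (curveκ p).DeltaHat := deltaHatκEquiv p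
  have hgen : (Subgroup.closure ({eta (FreeGroup.of (0 : Fin 2)), eta (FreeGroup.of 1)} : Set F₂hatT)).topologicalClosure = ⊤ :=
    topologicalClosure_closure_eta_pair
  rw [eq_top_iff]
  rintro y -
  have hy : e.symm y ∈ (Subgroup.closure ({eta (FreeGroup.of (0 : Fin 2)), eta (FreeGroup.of 1)} : Set F₂hatT)).topologicalClosure := by
    rw [hgen]; exact Subgroup.mem_top _
  have himg : (Subgroup.closure ({eta (FreeGroup.of (0 : Fin 2)), eta (FreeGroup.of 1)} : Set F₂hatT)).map
      e.toMulEquiv.toMonoidHom =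
      Subgroup.closure ({⟨SemidirectProduct.inl (eta (FreeGroup.of 0)), inl_mem_deltaHatκ p _⟩,
        ⟨SemidirectProduct.inl (eta (FreeGroup.of 1)), inl_mem_deltaHatκ p _⟩} :
        Set (ThetaSetting.modelκ' p).DeltaHat) := by
    rw [MonoidHom.map_closure, Set.image_pair]; rfl
  have hmap := DLocObj.map_topologicalClosure_equiv e
    (Subgroup.closure ({eta (FreeGroup.of (0 : Fin 2)), eta (FreeGroup.of 1)} : Set F₂hatT))
  have : e (e.symm y) ∈ ((Subgroup.closure ({eta (FreeGroup.of (0 : Fin 2)), eta (FreeGroup.of 1)} :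
      Set F₂hatT)).topologicalClosure).map e.toMulEquiv.toMonoidHom := ⟨_, hy, rfl⟩
  rw [hmap, himg, ContinuousMulEquiv.apply_symm_apply] at this
  exact this

end Literature.AnabelianGeometry.EtaleTheta.SettingModel

end
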